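import Summits.MatrixMultiplication.MatrixMultiplication.Theorems.EdgePencilExcess
import HarnessLib

/-!
# The defect cone of the `K₄` carving and the pricing of its two-leaf cuts

Support kernel for `stmt-MatrixMultiplication-26697` (`TetraExcessZero : ω(K₄) ≤ ω(2,1,2)`, the
attacked leaf of the cut of record `closes : TetraExcessZero → TetraNoSaving → ω = 2`, rev. 5) of route
`TetrahedronCarving` (lineage `decomp-mm-lens-6`, generation 21; barrier-complement carving).
Companions: `EdgePencilDefectCuts` (the cuts at the route's declarations), `EdgePencilDefectWeb` (sharpness).

The three DEFECTS of the carving: `d := ω − 2` (the summit is `d = 0`), `ρ := ω(2,1,2) − 4 = 2·(ω(1,1/2,1) − 2)`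
(the RECTANGULAR defect of the diamond `K₄ − e`; `ρ = 0 ⟺ α ≥ 1/2`), `t := ω(K₄) − 4` (`t = 0 ⟺ TetraFlat`).

* §1 **The recorded cone**: `0 ≤ ρ ≤ t ≤ 2d`, `ρ ≤ d` (cherry cover) and — the one non-trivial face — the
  CHORD `ρ ≤ κ(a)·d` for every `0 ≤ a ≤ min(α, 1/2)`, `κ(a) := (1 − 2a)/(1 − a)` (convexity of
  `k ↦ ω(1,k,1)` with its flat segment `[0, α]`; `κ(0) = 1`, `κ < 1 ⟺ a > 0`, `κ(0.3213) < 0.5267`).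
* §2 **Two pencils of leaves through the cut of record**: `A_k : t ≤ k·ρ` (`A_0 = TetraFlat`,
  `A_1 = TetraExcessZero`, `A_2 : ω(K₄) + 4 ≤ 2ω(2,1,2)` «the sixth edge is no dearer than the other five»;
  monotone in `k`) and `B_c : 4 + c·d ≤ ω(K₄)` (`B_2 = TetraNoSaving`, `B_1 = TetraPlusTwo :
  ω + 2 ≤ ω(K₄)`; antitone in `c`; a THEOREM for `c ≤ 0`, open for every `c > 0`). All members are NEC.
* §3 **The pricing theorem** (`omega_eq_two_of_defectRatioLE_of_transferGE`): for `0 ≤ k`, `0 ≤ a ≤ min(α,1/2)`: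
  `A_k ∧ B_c ⟹ ω = 2` whenever `c > k·κ(a)` (`c·d ≤ t ≤ k·ρ ≤ k·κ(a)·d` forces `d = 0`). Instances: `a = 0`
  gives `c > k` (the cut of record `(1,2)`, the original `(0,2)`); ANY `α > 0` (Coppersmith 1982 — the tree decl
  `coppersmith1982_dualExponentAlpha_gt`, kept as the hypothesis `0 < dualExponentAlpha`) gives `0 < c`, `k ≤ c`:
  `TetraExcessZero ∧ TetraPlusTwo ⟹ ω = 2` and `A_2 ∧ TetraNoSaving ⟹ ω = 2` — EITHER leaf of the cut of record
  may be weakened one notch, not both (`A_2 ∧ B_1 ⟹ ω = 2` needs `α > 1/3`, just above the record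
  `α > 0.321334`); the record `α ≥ 0.3213` prices the residual down to `A_k`, `k ≤ 3.79`, and the attacked leaf
  down to `B_c`, `c ≥ 0.5267`.
* §4 **Cores**: every `A_k` contains `HalfAlpha → TetraFlat` (`ρ = 0 → t = 0`), every `B_c`, `c > 0`, contains
  `TetraFlat → ω = 2` (`t = 0 → d = 0`): the pencils are one-parameter thickenings of the two halves of
  `TetraFlat`'s position between `α ≥ 1/2` and the summit.

References: Christandl–Vrana–Zuiddam, arXiv:1609.07476, §1.2–1.3 (graph tensors, `ω(K₄)`, Question 1.3.2);
Lotti–Romani 1983 (`ω(1,k,1)` convex, flat on `[0,α]`); Coppersmith 1982 (`α > 0.17227`);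
Vassilevska Williams–Xu–Xu–Zhou 2024 (`α > 0.321334`); Brand et al. 2026, Thm. 48 (`ω(K₄) < 4.633908`).
[ChristandlVranaZuiddam2016] [LottiRomani1983] [Coppersmith1982] [VassilevskaWilliamsXuXuZhou2024] [BrandEtAl2026]
-/

noncomputable section

set_option linter.dupNamespace false

open Literature.Computability.AlgebraicComplexity
open Summit.MatrixMultiplication.MatrixMultiplication.Theorems.TetrahedronTensor
open Summit.MatrixMultiplication.MatrixMultiplication.Theses.TetrahedronCarving

namespace Summit.MatrixMultiplication.MatrixMultiplication.Theorems.EdgePencil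

section DefectCone

variable (F : Type) [Field F]

/-! ## §1 The recorded defect cone `0 ≤ ρ ≤ t ≤ 2d`, `ρ ≤ κ(a)·d` -/

/-- `0 ≤ d`. -/
theorem defect_nonneg : 0 ≤ omega F - 2 := sub_nonneg.2 (omega_two_le F)

/-- `0 ≤ ρ`. [cite: HuangPan1998, §2 eq. (2.8) (p. 262)] -/
theorem rectDefect_nonneg : 0 ≤ omegaRect F 2 1 2 - 4 :=
  sub_nonneg.2 (four_le_omegaRect_two_one_two F)

/-- `ρ ≤ t` (grouping floor). [cite: ChristandlVranaZuiddam2016, §1.2] -/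
theorem rectDefect_le_tetraDefect : omegaRect F 2 1 2 - 4 ≤ omegaTetra F - 4 := by
  linarith [omegaRect_two_one_two_le_omegaTetra F]

/-- `t ≤ 2d` (cover by two triangles). [cite: ChristandlVranaZuiddam2016, Prop. 1.1.26] -/
theorem tetraDefect_le_two_mul_defect : omegaTetra F - 4 ≤ 2 * (omega F - 2) := by
  linarith [omegaTetra_le_two_mul_omega F]

/-- `ρ ≤ d` (cherry cover `ω(2,1,2) = ψ(1) ≤ ω + 2`). -/
theorem rectDefect_le_defect : omegaRect F 2 1 2 - 4 ≤ omega F - 2 := by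
  have h := omegaPencil_one_le_omega_add_two F
  rw [omegaPencil_one_eq_omegaRect_two_one_two] at h
  linarith

/-- **The chord face** `ρ ≤ κ(a)·d`, `κ(a) = (1 − 2a)/(1 − a)`, for every `0 ≤ a ≤ 1/2` with `a ≤ α`.
[cite: LottiRomani1983, §3] -/
theorem rectDefect_le_kappa_mul_defect {a : ℝ} (ha0 : 0 ≤ a) (ha : a ≤ 1 / 2)
    (hα : a ≤ dualExponentAlpha F) :
    omegaRect F 2 1 2 - 4 ≤ (1 - 2 * a) / (1 - a) * (omega F - 2) := by
  have h2 := omegaRect_half_le_chord F ha0 ha hα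
  have hid : (1 - 2 * a) / (1 - a) = 2 * ((1 / 2 - a) / (1 - a)) := by
    rw [mul_div_assoc']
    congr 1
    ring
  rw [← omegaPencil_one_eq_omegaRect_two_one_two, omegaPencil_one_eq, hid]
  linarith

/-- `0 ≤ κ(a) ≤ 1` on `0 ≤ a ≤ 1/2`, and `κ(a) < 1 ⟺ 0 < a`. -/
theorem kappa_bounds {a : ℝ} (ha0 : 0 ≤ a) (ha : a ≤ 1 / 2) :
    0 ≤ (1 - 2 * a) / (1 - a) ∧ (1 - 2 * a) / (1 - a) ≤ 1 ∧ ((1 - 2 * a) / (1 - a) < 1 ↔ 0 < a) := by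
  have h1a : 0 < 1 - a := by linarith
  refine ⟨div_nonneg (by linarith) h1a.le, ?_, ?_⟩
  · rw [div_le_one h1a]
    linarith
  · rw [div_lt_one h1a]
    constructor <;> intro h <;> linarith

/-- **THE DEFECT CONE** recorded in the tree: `0 ≤ ρ ≤ t ≤ 2d`, `ρ ≤ d`, `t ≤ ρ + (2d − ρ)`; with the chord
face `rectDefect_le_kappa_mul_defect`. -/
theorem defectCone :
    0 ≤ omegaRect F 2 1 2 - 4 ∧ omegaRect F 2 1 2 - 4 ≤ omegaTetra F - 4 ∧
      omegaTetra F - 4 ≤ 2 * (omega F - 2) ∧ omegaRect F 2 1 2 - 4 ≤ omega F - 2 ∧ 0 ≤ omega F - 2 :=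
  ⟨rectDefect_nonneg F, rectDefect_le_tetraDefect F, tetraDefect_le_two_mul_defect F,
    rectDefect_le_defect F, defect_nonneg F⟩

/-! ## §2 The two pencils of leaves -/

/-- `A_0 ⟺ ω(K₄) ≤ 4` (`TetraFlat`). -/
theorem defectRatioLE_zero_iff :
    omegaTetra F - 4 ≤ 0 * (omegaRect F 2 1 2 - 4) ↔ omegaTetra F ≤ 4 := by
  constructor <;> intro h <;> linarith

/-- `A_1 ⟺ ω(K₄) ≤ ω(2,1,2)` (`TetraExcessZero`). -/
theorem defectRatioLE_one_iff :
    omegaTetra F - 4 ≤ 1 * (omegaRect F 2 1 2 - 4) ↔ omegaTetra F ≤ omegaRect F 2 1 2 := by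
  constructor <;> intro h <;> linarith

/-- `A_2 ⟺ ω(K₄) + 4 ≤ 2·ω(2,1,2)` (the sixth edge costs at most what the fifth did: `t − ρ ≤ ρ − 0`). -/
theorem defectRatioLE_two_iff :
    omegaTetra F - 4 ≤ 2 * (omegaRect F 2 1 2 - 4) ↔ omegaTetra F + 4 ≤ 2 * omegaRect F 2 1 2 := by
  constructor <;> intro h <;> linarith

/-- `B_2 ⟺ 2ω ≤ ω(K₄)` (`TetraNoSaving`). -/
theorem transferGE_two_iff :
    4 + 2 * (omega F - 2) ≤ omegaTetra F ↔ 2 * omega F ≤ omegaTetra F := by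
  constructor <;> intro h <;> linarith

/-- `B_1 ⟺ TetraPlusTwo : ω + 2 ≤ ω(K₄)`. -/
theorem transferGE_one_iff :
    4 + 1 * (omega F - 2) ≤ omegaTetra F ↔ omega F + 2 ≤ omegaTetra F := by
  constructor <;> intro h <;> linarith

/-- `A_k` is monotone in `k` (`ρ ≥ 0`). -/
theorem defectRatioLE_mono {k k' : ℝ} (hkk : k ≤ k')
    (h : omegaTetra F - 4 ≤ k * (omegaRect F 2 1 2 - 4)) :
    omegaTetra F - 4 ≤ k' * (omegaRect F 2 1 2 - 4) :=
  le_trans h (mul_le_mul_of_nonneg_right hkk (rectDefect_nonneg F))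

/-- `B_c` is antitone in `c` (`d ≥ 0`). -/
theorem transferGE_anti {c c' : ℝ} (hcc : c' ≤ c) (h : 4 + c * (omega F - 2) ≤ omegaTetra F) :
    4 + c' * (omega F - 2) ≤ omegaTetra F := by
  have := mul_le_mul_of_nonneg_right hcc (defect_nonneg F)
  linarith

/-- **Proved members of the `B`-pencil**: `B_c` holds for every `c ≤ 0` (`4 ≤ ω(K₄)`). -/
theorem transferGE_of_nonpos {c : ℝ} (hc : c ≤ 0) : 4 + c * (omega F - 2) ≤ omegaTetra F := by
  have h4 := four_le_omegaTetra F
  have := mul_nonpos_iff.2 (Or.inr ⟨hc, defect_nonneg F⟩)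
  linarith

/-- NEC for the whole `A`-pencil: `ω = 2 ⟹ A_k` for every `k` (`t = ρ = 0`). -/
theorem defectRatioLE_of_omega_eq_two (k : ℝ) (hω : omega F = 2) :
    omegaTetra F - 4 ≤ k * (omegaRect F 2 1 2 - 4) := by
  have ht : omegaTetra F ≤ 4 := by
    have := omegaTetra_le_two_mul_omega F
    rw [hω] at this
    linarith
  have hρ : omegaRect F 2 1 2 - 4 = 0 := by
    linarith [four_le_omegaRect_two_one_two F, omegaRect_two_one_two_le_omegaTetra F]
  rw [hρ, mul_zero]
  linarith

/-- NEC for the whole `B`-pencil: `ω = 2 ⟹ B_c` for every `c` (`d = 0`). -/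
theorem transferGE_of_omega_eq_two (c : ℝ) (hω : omega F = 2) :
    4 + c * (omega F - 2) ≤ omegaTetra F := by
  rw [hω, sub_self, mul_zero, add_zero]
  exact four_le_omegaTetra F

/-! ## §3 The pricing theorem: `A_k ∧ B_c ⟹ ω = 2` exactly when `c > k·κ(α)` -/

/-- **THE PRICING THEOREM.** For `0 ≤ k`, `0 ≤ a ≤ 1/2`, `a ≤ α` and `c > k·(1 − 2a)/(1 − a)`:
`A_k ∧ B_c ⟹ ω = 2` (`c·d ≤ t ≤ k·ρ ≤ k·κ(a)·d` forces `d = 0`). [cite: LottiRomani1983, §3] -/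
theorem omega_eq_two_of_defectRatioLE_of_transferGE {k c a : ℝ} (ha0 : 0 ≤ a) (ha : a ≤ 1 / 2)
    (hα : a ≤ dualExponentAlpha F) (hk : 0 ≤ k) (hkc : k * ((1 - 2 * a) / (1 - a)) < c)
    (hA : omegaTetra F - 4 ≤ k * (omegaRect F 2 1 2 - 4)) (hB : 4 + c * (omega F - 2) ≤ omegaTetra F) :
    omega F = 2 := by
  have hd := defect_nonneg F
  have hρ := rectDefect_le_kappa_mul_defect F ha0 ha hα
  have h2 : k * (omegaRect F 2 1 2 - 4) ≤ k * ((1 - 2 * a) / (1 - a) * (omega F - 2)) :=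
    mul_le_mul_of_nonneg_left hρ hk
  rcases hd.eq_or_lt with h0 | hpos
  · linarith
  · have h3 : k * ((1 - 2 * a) / (1 - a)) * (omega F - 2) < c * (omega F - 2) :=
      mul_lt_mul_of_pos_right hkc hpos
    have h4 : k * ((1 - 2 * a) / (1 - a) * (omega F - 2)) =
        k * ((1 - 2 * a) / (1 - a)) * (omega F - 2) := by ring
    linarith

/-- The chord-free instance `a = 0`: **`A_k ∧ B_c ⟹ ω = 2` whenever `0 ≤ k < c`** (this is the cut of
record at `(k,c) = (1,2)` and the original cut at `(0,2)`). -/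
theorem omega_eq_two_of_defectRatioLE_of_transferGE_of_lt {k c : ℝ} (hk : 0 ≤ k) (hkc : k < c)
    (hA : omegaTetra F - 4 ≤ k * (omegaRect F 2 1 2 - 4)) (hB : 4 + c * (omega F - 2) ≤ omegaTetra F) :
    omega F = 2 :=
  omega_eq_two_of_defectRatioLE_of_transferGE F le_rfl (by norm_num) (dualExponentAlpha_nonneg F) hk
    (by simpa using hkc) hA hB

/-- With ANY `α > 0` (Coppersmith 1982; tree decl `coppersmith1982_dualExponentAlpha_gt`, taken as a
hypothesis): **`A_k ∧ B_c ⟹ ω = 2` whenever `0 ≤ k ≤ c`, `0 < c`** — the diagonal is reached.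
[cite: Coppersmith1982, Thm. 1] -/
theorem omega_eq_two_of_defectRatioLE_of_transferGE_of_le (hαpos : 0 < dualExponentAlpha F) {k c : ℝ}
    (hk : 0 ≤ k) (hc : 0 < c) (hkc : k ≤ c) (hA : omegaTetra F - 4 ≤ k * (omegaRect F 2 1 2 - 4))
    (hB : 4 + c * (omega F - 2) ≤ omegaTetra F) :
    omega F = 2 := by
  set a : ℝ := min (dualExponentAlpha F) (1 / 2) with ha_def
  have ha0 : 0 < a := lt_min hαpos (by norm_num)
  have ha : a ≤ 1 / 2 := min_le_right _ _
  have hα : a ≤ dualExponentAlpha F := min_le_left _ _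
  have hκ1 : (1 - 2 * a) / (1 - a) < 1 := ((kappa_bounds ha0.le ha).2.2).2 ha0
  have hkc' : k * ((1 - 2 * a) / (1 - a)) < c := by
    rcases hk.eq_or_lt with h0 | hkpos
    · rw [← h0, zero_mul]
      exact hc
    · exact lt_of_lt_of_le (mul_lt_of_lt_one_right hkpos hκ1) hkc
  exact omega_eq_two_of_defectRatioLE_of_transferGE F ha0.le ha hα hk hkc' hA hB

/-- **One notch off the residual**: given `α > 0`, `TetraExcessZero ∧ TetraPlusTwo ⟹ ω = 2`
(`ω(K₄) ≤ ω(2,1,2)` and `ω + 2 ≤ ω(K₄)`). [cite: Coppersmith1982, Thm. 1] -/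
theorem omega_eq_two_of_excessZero_of_plusTwo (hαpos : 0 < dualExponentAlpha F)
    (hA : omegaTetra F ≤ omegaRect F 2 1 2) (hB : omega F + 2 ≤ omegaTetra F) : omega F = 2 :=
  omega_eq_two_of_defectRatioLE_of_transferGE_of_le F hαpos zero_le_one one_pos le_rfl
    ((defectRatioLE_one_iff F).2 hA) ((transferGE_one_iff F).2 hB)

/-- **One notch off the attacked leaf**: given `α > 0`, `A_2 ∧ TetraNoSaving ⟹ ω = 2`
(`ω(K₄) + 4 ≤ 2ω(2,1,2)` and `2ω ≤ ω(K₄)`). [cite: Coppersmith1982, Thm. 1] -/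
theorem omega_eq_two_of_doubleDefect_of_noSaving (hαpos : 0 < dualExponentAlpha F)
    (hA : omegaTetra F + 4 ≤ 2 * omegaRect F 2 1 2) (hB : 2 * omega F ≤ omegaTetra F) : omega F = 2 :=
  omega_eq_two_of_defectRatioLE_of_transferGE_of_le F hαpos (by norm_num) two_pos le_rfl
    ((defectRatioLE_two_iff F).2 hA) ((transferGE_two_iff F).2 hB)

/-- **Both notches need `α > 1/3`**: `1/3 < α ⟹ (A_2 ∧ TetraPlusTwo ⟹ ω = 2)` (`2κ(a) < 1 ⟺ a > 1/3`;
the record is `α > 0.321334`, so today this cut is NOT certified — see `DefectWeb.thirdWorld`).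
[cite: VassilevskaWilliamsXuXuZhou2024, Thm. 1.2] -/
theorem omega_eq_two_of_doubleDefect_of_plusTwo (hα3 : 1 / 3 < dualExponentAlpha F)
    (hA : omegaTetra F + 4 ≤ 2 * omegaRect F 2 1 2) (hB : omega F + 2 ≤ omegaTetra F) : omega F = 2 := by
  set a : ℝ := min (dualExponentAlpha F) (1 / 2) with ha_def
  have ha3 : 1 / 3 < a := lt_min hα3 (by norm_num)
  have ha : a ≤ 1 / 2 := min_le_right _ _
  have hα : a ≤ dualExponentAlpha F := min_le_left _ _
  have h1a : 0 < 1 - a := by linarith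
  have hκ : (1 - 2 * a) / (1 - a) < 1 / 2 := by
    rw [div_lt_iff₀ h1a]
    linarith
  exact omega_eq_two_of_defectRatioLE_of_transferGE F (by linarith) ha hα (by norm_num)
    (show 2 * ((1 - 2 * a) / (1 - a)) < 1 by linarith) ((defectRatioLE_two_iff F).2 hA)
    ((transferGE_one_iff F).2 hB)

/-- **Pricing the residual of record** at the printed `α ≥ 0.3213`: `A_k ∧ TetraNoSaving ⟹ ω = 2` for every
`0 ≤ k ≤ 3.79` (`κ(0.3213) < 0.5267`, `3.79·0.5267 < 2`). [cite: VassilevskaWilliamsXuXuZhou2024, Thm. 1.2] -/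
theorem omega_eq_two_of_defectRatioLE_of_noSaving_record (hα : (0.3213 : ℝ) ≤ dualExponentAlpha F)
    {k : ℝ} (hk : 0 ≤ k) (hk' : k ≤ 3.79) (hA : omegaTetra F - 4 ≤ k * (omegaRect F 2 1 2 - 4))
    (hB : 2 * omega F ≤ omegaTetra F) :
    omega F = 2 := by
  have hκ : (1 - 2 * (0.3213 : ℝ)) / (1 - 0.3213) ≤ 0.5267 := by
    rw [div_le_iff₀ (by norm_num)]
    norm_num
  have hkc : k * ((1 - 2 * (0.3213 : ℝ)) / (1 - 0.3213)) < 2 :=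
    calc k * ((1 - 2 * (0.3213 : ℝ)) / (1 - 0.3213)) ≤ k * 0.5267 := mul_le_mul_of_nonneg_left hκ hk
      _ ≤ 3.79 * 0.5267 := mul_le_mul_of_nonneg_right hk' (by norm_num)
      _ < 2 := by norm_num
  exact omega_eq_two_of_defectRatioLE_of_transferGE F (by norm_num) (by norm_num) hα hk hkc hA
    ((transferGE_two_iff F).2 hB)

/-- **Pricing the attacked leaf of record** at `α ≥ 0.3213`: `TetraExcessZero ∧ B_c ⟹ ω = 2` for every
`c ≥ 0.5267`. [cite: VassilevskaWilliamsXuXuZhou2024, Thm. 1.2] -/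
theorem omega_eq_two_of_excessZero_of_transferGE_record (hα : (0.3213 : ℝ) ≤ dualExponentAlpha F)
    {c : ℝ} (hc : 0.5267 ≤ c) (hA : omegaTetra F ≤ omegaRect F 2 1 2)
    (hB : 4 + c * (omega F - 2) ≤ omegaTetra F) :
    omega F = 2 := by
  have hκ : (1 - 2 * (0.3213 : ℝ)) / (1 - 0.3213) < 0.5267 := by
    rw [div_lt_iff₀ (by norm_num)]
    norm_num
  exact omega_eq_two_of_defectRatioLE_of_transferGE F (by norm_num) (by norm_num) hα zero_le_one
    (by linarith) ((defectRatioLE_one_iff F).2 hA) hB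

/-! ## §4 Cores: every `A_k` contains `HalfAlpha → TetraFlat`, every `B_c (c > 0)` contains `TetraFlat → ω = 2` -/

/-- `A_k ⟹ (ω(2,1,2) ≤ 4 → ω(K₄) ≤ 4)`, i.e. `A_k ⟹ (HalfAlpha → TetraFlat)`, for every `k`. -/
theorem omegaTetra_le_four_of_defectRatioLE {k : ℝ}
    (hA : omegaTetra F - 4 ≤ k * (omegaRect F 2 1 2 - 4))
    (hρ : omegaRect F 2 1 2 ≤ 4) : omegaTetra F ≤ 4 := by
  have h0 : omegaRect F 2 1 2 - 4 = 0 := by linarith [four_le_omegaRect_two_one_two F]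
  rw [h0, mul_zero] at hA
  linarith

/-- `B_c ⟹ (ω(K₄) ≤ 4 → ω = 2)` for every `c > 0`, i.e. `B_c ⟹ (TetraFlat → ω = 2)`. -/
theorem omega_eq_two_of_transferGE_of_omegaTetra_le_four {c : ℝ} (hc : 0 < c)
    (hB : 4 + c * (omega F - 2) ≤ omegaTetra F)
    (ht : omegaTetra F ≤ 4) : omega F = 2 := by
  have hd := defect_nonneg F
  have h1 : c * (omega F - 2) ≤ 0 := by linarith
  rcases hd.eq_or_lt with h0 | hpos
  · linarith
  · exact absurd h1 (not_le.2 (mul_pos hc hpos))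

end DefectCone

end Summit.MatrixMultiplication.MatrixMultiplication.Theorems.EdgePencil

end
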